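import Summits.HodgeConjecture.HodgeConjecture.Theorems.Ring2AbelianAllWeilSimilarCells
import Summits.HodgeConjecture.HodgeConjecture.Theorems.Ring2AbelianAllWeilFloorLandherr
import Summits.HodgeConjecture.HodgeConjecture.Theorems.WeilTypeLadderSimilarReach
import HarnessLib

/-!
# Ring 2 · AbelianAll (ab-weil-1, gen 10, part 8g) — Stage C: door B PER CELL — one locally algebraic
  anchor in the cell `(n, d, δ)` + Deligne's reach-by-similitude ⟹ the Weil classes of EVERY member of the cell

research route, not a corollary; conditional on HC_CM plus one named minimal statement.
Cell line: research route conditional on HC_CM; not a corollary; Q11.4-sentence-2 already refuted in dim ≥ 3.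
`HC_CM` (`Theses.RankFourFaces.CMAbelianHodge`) does not occur in this file and no open case of the Hodge
conjecture is claimed.

## What is PROVED here (0 sorry)

Parts 8c/8f proved van Geemen 5.2 (3)–(4) on the carriers: two polarized abelian varieties of Weil type `(n, d)`
whose `K_d`-Hermitian forms have the same discriminant class `δ ∈ ℚ^×/Nm(K_d^×)` are WEIL-SIMILAR
(`Motives.IsWeilSimilar`).  The tree's print engine of the Weil column ("door B",
`WeilTypeLadder.weilClassesOf_le_algebraicClasses_of_reachSimilar_of_similarAnchor`, from the NAMED print fact
`HodgeTheory.weilFamilyReach_similar` = Deligne, LNM 900, proof of Thm. 4.8) makes the Weil plane of `(A, φ)`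
algebraic as soon as `(A, φ)` is Weil-similar to a LOCALLY ALGEBRAIC ANCHOR `(P, ψ₀, w)`
(`HodgeTheory.WeilAnchorLocalClause`).  Composing:

* §1 `isWeilSimilar_of_hasWeilDiscriminantNondeg` — Stage B repackaged on van Geemen's predicate
  `HasWeilDiscriminantNondeg`: same class `δ` ⟹ `IsWeilSimilar` (no instance hypotheses).
* §2 `HasLocallyAlgebraicWeilAnchorInClass n d δ` (open per-cell statement: if the cell `(n, d, δ)` is realisable,
  `sign δ = (-1)ⁿ`, some member of it carries a non-zero rational Weil class satisfying the anchor's local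
  clause) and the PER-CELL door-B row
  `weilClassesComponent_of_reachSimilar_of_anchorInClass :
     weilFamilyReach_similar → HasLocallyAlgebraicWeilAnchorInClass n d δ → WeilClassesComponent n d δ`.
* §3 `hasSimilarLocallyAlgebraicWeilAnchors_of_anchorInClass` — hweil's per-`(n, d)` node
  `HasSimilarLocallyAlgebraicWeilAnchors n d` from `∀ δ, HasLocallyAlgebraicWeilAnchorInClass n d δ` (content on
  the right-sign classes `weilSign d δ = (-1)ⁿ` only; the other classes carry no member, part 5).
* §4 the rows: `WeilClassesByComponent`, the floor `HC(A)` for `dim A ≤ 5` from the four refereed print facts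
  + `weilFamilyReach_similar` + one anchor in each positive non-split squarefree fourfold cell, and R1
  (`WeilSixfolds`) from anchors in the negative sixfold cells.

So on every open cell the column now has TWO recorded residual shapes: (N73 `IsogenyConnectedToCMAnchor n d δ` ∧
`WeilVariationalHodgeComponent n d δ`) [parts 7, 8d] and, ALTERNATIVELY, (`weilFamilyReach_similar` [print,
named] ∧ `HasLocallyAlgebraicWeilAnchorInClass n d δ` [ONE member, ONE class, ONE local deformation clause]).
Neither is re-based on the other.

What is NOT proved or claimed: the local clause for any anchor; `weilFamilyReach_similar`; N73 on any non-split
right-sign cell; `HC` for any abelian variety not already covered in the tree.  No Literature fact is introduced;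
no internally-minted statement is cited as a fact.

## References

* [Deligne1982HodgeCycles] P. Deligne, LNM 900 (1982), Prop. 4.4, Lemma 4.6, proof of Thm. 4.8 (pp. 47–52).
* [vanGeemen1994HodgeAV] B. van Geemen, LNM 1594 (1994), 4.10–4.14, Lemma 5.2 (1)–(4), Thm. 5.3, 5.8–5.11.
* [Schoen1998HodgeWeilAddendum] C. Schoen, Addendum (1998), §10.
* [MoonenZarhin1999] B. Moonen, Yu. Zarhin, Duke Math. J. 77 (1995) / Indag. Math. (1999), Thm. 0.1.
* [Landherr1936HermitianForms] W. Landherr, Abh. Math. Sem. Hamburg 11 (1936).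
-/

noncomputable section

set_option linter.dupNamespace false

open CategoryTheory Polynomial NumberField
open Literature.AlgebraicGeometry Literature.AlgebraicGeometry.Motives
open Literature.AlgebraicGeometry.HodgeTheory
open Literature.AlgebraicGeometry.VanGeemen1994
open Literature.AlgebraicTopology.SingularHomology
open Summit.HodgeConjecture.HodgeConjecture.Ring2.Hypotheses

namespace Summit.HodgeConjecture.HodgeConjecture.Ring2.AbelianAll

/-! ### §1 Stage B on van Geemen's predicate -/

/-- **Same discriminant class ⟹ Weil-similar** (van Geemen 5.2 (3)–(4) / Deligne, proof of 4.8, on the carriers):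
two polarized abelian varieties `(A, φ, h_K)`, `(A', φ', h'_K)` of Weil type `(n, d)` admitting non-degenerate
Gram witnesses of the SAME class `δ ∈ ℚ^×/Nm(K_d^×)` are `Motives.IsWeilSimilar`.  Part 8f's
`isWeilSimilar_of_weilDiscriminantClass_eq` with the instances `Fact (Irreducible (X² + d))`, `IsCMField K_d`
supplied. [cite: vanGeemen1994HodgeAV, Lemma 5.2 (3)–(4) and Thm. 5.3] [cite: Deligne1982HodgeCycles, proof of Thm. 4.8] -/
theorem isWeilSimilar_of_hasWeilDiscriminantNondeg {A A' : AbelianVariety ℂ} {φ : A ⟶ A} {φ' : A' ⟶ A'}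
    {n d : ℕ} (hW : IsWeilType A φ n d) (hW' : IsWeilType A' φ' n d)
    (e : ProjectiveEmbedding A.X) {a : complexBetti (projectiveSpace e.n ℂ) 2} (haQ : IsRationalClass a)
    (ha0 : a ≠ 0) (e' : ProjectiveEmbedding A'.X) {a' : complexBetti (projectiveSpace e'.n ℂ) 2}
    (ha'Q : IsRationalClass a') (ha'0 : a' ≠ 0) {δ : weilNormResidueGroup d}
    (hδ : HasWeilDiscriminantNondeg A φ n d
      ((d : ℂ) • complexBetti.map e.ι 2 a + complexBetti.map φ.hom.hom.hom 2 (complexBetti.map e.ι 2 a)) δ)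
    (hδ' : HasWeilDiscriminantNondeg A' φ' n d
      ((d : ℂ) • complexBetti.map e'.ι 2 a' + complexBetti.map φ'.hom.hom.hom 2 (complexBetti.map e'.ι 2 a')) δ) :
    Motives.IsWeilSimilar n A φ
      ((d : ℂ) • complexBetti.map e.ι 2 a + complexBetti.map φ.hom.hom.hom 2 (complexBetti.map e.ι 2 a)) A' φ'
      ((d : ℂ) • complexBetti.map e'.ι 2 a' + complexBetti.map φ'.hom.hom.hom 2 (complexBetti.map e'.ι 2 a')) := by
  haveI : Fact (Irreducible (X ^ 2 + C (d : ℚ) : ℚ[X])) := fact_irreducible_weilPoly hW.d_pos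
  haveI : IsCMField (weilField d) := isCMField_weilField
  obtain ⟨x, ω, am, bm, q, hx, hind, hω, hω0, hQ, hdet, hq⟩ := hδ
  obtain ⟨x', ω', am', bm', q', hx', hind', hω', hω'0, hQ', hdet', hq'⟩ := hδ'
  have hmn : 2 * n = 2 * n - 1 + 1 := by have := hW.pos; omega
  exact isWeilSimilar_of_weilDiscriminantClass_eq hW hW' hmn e haQ ha0 x ω am bm q hx hind hω hω0 hQ hdet
    e' ha'Q ha'0 x' ω' am' bm' q' hx' hind' hω' hω'0 hQ' hdet' (hq.trans hq'.symm)

/-! ### §2 One locally algebraic anchor per cell -/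

/-- **`HasLocallyAlgebraicWeilAnchorInClass n d δ`** — IF the cell `(n, d, δ)` is realisable
(`sign δ = (-1)ⁿ`, van Geemen 4.14; the other classes carry no Weil-type member, part 5) THEN it contains a
LOCALLY ALGEBRAIC ANCHOR: an abelian `2n`-fold `P` with `ψ₀² = -d`, a projective embedding `e` and a rational
`a ≠ 0` (polarization class `h_K = d·e^*a + ψ₀^*e^*a`), a non-zero rational class `w` of its Weil plane of Hodge
type `(n, n)` satisfying the local clause `HodgeTheory.WeilAnchorLocalClause n d P h_K w` (along every smooth
projective `√-d`-Weil family through a chart at `P`, `q·Hⁿ + W` stays algebraic near `P` — the local output of a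
semiregularity theorem at the anchor), and a non-degenerate Gram witness of class `δ`
(`HasWeilDiscriminantNondeg P ψ₀ n d h_K δ`: `(P, ψ₀, h_K)` lies in the cell).  The per-cell find-the-cycle
target of door B; internally posed, OPEN on every realisable cell not covered by print, never cited as a fact.
[cite: Deligne1982HodgeCycles, proof of Thm. 4.8] [cite: Schoen1998HodgeWeilAddendum, §10]
[cite: vanGeemen1994HodgeAV, 4.14 and Lemma 5.2 (3)] [status: open] -/
@[conjecture] def HasLocallyAlgebraicWeilAnchorInClass (n d : ℕ) (δ : weilNormResidueGroup d) : Prop :=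
  weilSign d δ = (-1) ^ n →
  ∃ (P : AbelianVariety ℂ) (ψ₀ : P ⟶ P) (e : ProjectiveEmbedding P.X) (a : complexBetti (projectiveSpace e.n ℂ) 2)
    (w : complexBetti P.X (2 * n)),
    P.dim = 2 * n ∧ ψ₀ ≫ ψ₀ = -(d • 𝟙 P) ∧ IsRationalClass a ∧ a ≠ 0 ∧
    w ∈ weilClassesOf P ψ₀ n d ∧ IsRationalClass w ∧ w ≠ 0 ∧ IsOfHodgeType (2 * n) P.X (2 * n) n n w ∧
    WeilAnchorLocalClause n d P
      ((d : ℂ) • complexBetti.map e.ι 2 a + complexBetti.map ψ₀.hom.hom.hom 2 (complexBetti.map e.ι 2 a)) w ∧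
    HasWeilDiscriminantNondeg P ψ₀ n d
      ((d : ℂ) • complexBetti.map e.ι 2 a + complexBetti.map ψ₀.hom.hom.hom 2 (complexBetti.map e.ι 2 a)) δ

/-- **How to meet the target**: ANY polarized member `(P, ψ₀, h_K)` of Weil type `(n, d)` of the cell `(n, d, δ)`
and ANY non-zero rational class `w` of its Weil plane satisfying the local clause give
`HasLocallyAlgebraicWeilAnchorInClass n d δ` (the Hodge type `(n, n)` of `w` is automatic, van Geemen 4.10).
[cite: vanGeemen1994HodgeAV, 4.10 and Lemma 5.2 (6)] -/
theorem hasLocallyAlgebraicWeilAnchorInClass_of_member {P : AbelianVariety ℂ} {ψ₀ : P ⟶ P} {n d : ℕ}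
    (hW : IsWeilType P ψ₀ n d) (e : ProjectiveEmbedding P.X) {a : complexBetti (projectiveSpace e.n ℂ) 2}
    (haQ : IsRationalClass a) (ha0 : a ≠ 0) {δ : weilNormResidueGroup d}
    (hδ : HasWeilDiscriminantNondeg P ψ₀ n d
      ((d : ℂ) • complexBetti.map e.ι 2 a + complexBetti.map ψ₀.hom.hom.hom 2 (complexBetti.map e.ι 2 a)) δ)
    {w : complexBetti P.X (2 * n)} (hwW : w ∈ weilClassesOf P ψ₀ n d) (hwQ : IsRationalClass w) (hw0 : w ≠ 0)
    (hloc : WeilAnchorLocalClause n d P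
      ((d : ℂ) • complexBetti.map e.ι 2 a + complexBetti.map ψ₀.hom.hom.hom 2 (complexBetti.map e.ι 2 a)) w) :
    HasLocallyAlgebraicWeilAnchorInClass n d δ :=
  fun _ => ⟨P, ψ₀, e, a, w, hW.dim_eq, hW.sq_eq, haQ, ha0, hwW, hwQ, hw0, hW.isOfHodgeType_of_mem_weilClassesOf hwW,
    hloc, hδ⟩

/-- A Weil-type pair carries a non-zero class of its Weil plane of Hodge type `(n, n)` (the plane has
`dim_ℂ = 2`, van Geemen 5.2 (5), and consists of `(n, n)`-classes, 4.10). [cite: vanGeemen1994HodgeAV, 4.10 and Lemma 5.2 (5)] -/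
theorem exists_weilClass_ne_zero_of_isWeilType {A : AbelianVariety ℂ} {φ : A ⟶ A} {n d : ℕ}
    (hW : IsWeilType A φ n d) :
    ∃ wA : complexBetti A.X (2 * n),
      wA ∈ weilClassesOf A φ n d ∧ wA ≠ 0 ∧ IsOfHodgeType (2 * n) A.X (2 * n) n n wA := by
  have hne : weilClassesOf A φ n d ≠ ⊥ := by
    intro h
    have h2 := hW.finrank_weilClassesOf
    rw [h, finrank_bot] at h2
    exact absurd h2 (by norm_num)
  obtain ⟨wA, hwA, hwA0⟩ := Submodule.exists_mem_ne_zero_of_ne_bot hne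
  exact ⟨wA, hwA, hwA0, hW.isOfHodgeType_of_mem_weilClassesOf hwA⟩

/-- **Door B for one member**: under `weilFamilyReach_similar`, a polarized member `(A, φ, h_K)` of Weil type
`(n, d)` of the cell `(n, d, δ)` has its whole Weil plane algebraic as soon as the cell contains a locally
algebraic anchor — the anchor is Weil-similar to `(A, φ, h_K)` by §1. [cite: Deligne1982HodgeCycles, proof of Thm. 4.8]
[cite: Schoen1998HodgeWeilAddendum, §10] [cite: vanGeemen1994HodgeAV, Lemma 5.2 (3)–(4)] -/
theorem weilClassesOf_le_algebraicClasses_of_reachSimilar_of_anchorInClass {A : AbelianVariety ℂ} {φ : A ⟶ A}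
    {n d : ℕ} (hF : weilFamilyReach_similar) (hW : IsWeilType A φ n d) (eA : ProjectiveEmbedding A.X)
    {aA : complexBetti (projectiveSpace eA.n ℂ) 2} (haA : IsRationalClass aA) (haA0 : aA ≠ 0)
    {δ : weilNormResidueGroup d}
    (hδA : HasWeilDiscriminantNondeg A φ n d
      ((d : ℂ) • complexBetti.map eA.ι 2 aA + complexBetti.map φ.hom.hom.hom 2 (complexBetti.map eA.ι 2 aA)) δ)
    (hP : HasLocallyAlgebraicWeilAnchorInClass n d δ) :
    weilClassesOf A φ n d ≤ algebraicClasses A.X n := by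
  obtain ⟨P, ψ₀, e, a, w, hPdim, hψ, ha, ha0, hwW, hwQ, hw0, hwH, hloc, hδP⟩ :=
    hP (weilSign_eq_of_hasWeilDiscriminantNondeg hW eA haA haA0 hδA)
  have hWP : IsWeilType P ψ₀ n d := isWeilType_of_weilClass_ne_zero hW.pos hW.d_pos hPdim hψ hwW hw0 hwH
  exact WeilTypeLadder.weilClassesOf_le_algebraicClasses_of_reachSimilar_of_similarAnchor hF hW.pos hW.d_pos
    A φ hW.dim_eq hW.sq_eq (exists_weilClass_ne_zero_of_isWeilType hW)
    ⟨eA, aA, P, ψ₀, e, a, w, haA, haA0, hPdim, hψ, ha, ha0, hwW, hwQ, hw0, hwH, hloc,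
      isWeilSimilar_of_hasWeilDiscriminantNondeg hWP hW e ha ha0 eA haA haA0 hδP hδA⟩

/-- **DOOR B PER CELL.** `weilFamilyReach_similar → HasLocallyAlgebraicWeilAnchorInClass n d δ →
WeilClassesComponent n d δ` (`n, d ≥ 1`): Deligne's reach-by-similitude plus ONE locally algebraic anchor in
the cell make the Weil classes of EVERY member of the cell algebraic.  The alternative per-cell residual of the
Weil column (the residual of record stays N73 ∧ `WeilVariationalHodgeComponent`, parts 7/8d).
[cite: Deligne1982HodgeCycles, proof of Thm. 4.8] [cite: Schoen1998HodgeWeilAddendum, §10]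
[cite: vanGeemen1994HodgeAV, Lemma 5.2 (3)–(4), Thm. 5.3] -/
theorem weilClassesComponent_of_reachSimilar_of_anchorInClass {n d : ℕ} {δ : weilNormResidueGroup d}
    (hF : weilFamilyReach_similar) (hn : 0 < n) (hd : 0 < d) (hP : HasLocallyAlgebraicWeilAnchorInClass n d δ) :
    WeilClassesComponent n d δ := by
  intro A φ hA _ hφ e a ha ha0 hδA c _ hH hcW
  by_cases hc0 : c = 0
  · rw [hc0]; exact Submodule.zero_mem _
  · exact weilClassesOf_le_algebraicClasses_of_reachSimilar_of_anchorInClass hF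
      (isWeilType_of_weilClass_ne_zero hn hd hA hφ hcW hc0 hH) e ha ha0 hδA hP hcW

/-! ### §3 hweil's per-`(n, d)` node from anchors in the right-sign classes -/

/-- **`HasSimilarLocallyAlgebraicWeilAnchors n d` ⟸ `HasLocallyAlgebraicWeilAnchorInClass n d δ` for every
`δ`** (content only on the right-sign classes `sign δ = (-1)ⁿ`): every Weil-type `(A, φ)` of type `(n, n)` lies
in a right-sign cell (part 5, `weilSign_eq_of_hasWeilDiscriminantNondeg`) and is Weil-similar to that cell's
anchor (§1).
[cite: vanGeemen1994HodgeAV, 4.14 and Lemma 5.2 (1)–(4)] [cite: Deligne1982HodgeCycles, Prop. 4.4 and proof of Thm. 4.8] -/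
theorem hasSimilarLocallyAlgebraicWeilAnchors_of_anchorInClass {n d : ℕ} (hn : 0 < n) (hd : 0 < d)
    (h : ∀ δ : weilNormResidueGroup d, HasLocallyAlgebraicWeilAnchorInClass n d δ) :
    HasSimilarLocallyAlgebraicWeilAnchors n d := by
  intro A φ hA hφ hWA
  obtain ⟨wA, hwA, hwA0, hwAH⟩ := hWA
  have hW : IsWeilType A φ n d := isWeilType_of_weilClass_ne_zero hn hd hA hφ hwA hwA0 hwAH
  obtain ⟨eA, aA, δ, haA, haA0, hδA⟩ := exists_projectiveEmbedding_hasWeilDiscriminantNondeg hn hA hd hφ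
  obtain ⟨P, ψ₀, e, a, w, hPdim, hψ, ha, ha0, hwW, hwQ, hw0, hwH, hloc, hδP⟩ :=
    h δ (weilSign_eq_of_hasWeilDiscriminantNondeg hW eA haA haA0 hδA)
  have hWP : IsWeilType P ψ₀ n d := isWeilType_of_weilClass_ne_zero hn hd hPdim hψ hwW hw0 hwH
  exact ⟨eA, aA, P, ψ₀, e, a, w, haA, haA0, hPdim, hψ, ha, ha0, hwW, hwQ, hw0, hwH, hloc,
    isWeilSimilar_of_hasWeilDiscriminantNondeg hWP hW e ha ha0 eA haA haA0 hδP hδA⟩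

/-! ### §4 The rows through door B, per cell -/

/-- **`WeilClassesByComponent` ⟸ `weilFamilyReach_similar` ∧ `HasLocallyAlgebraicWeilAnchorInClass n d δ` on
every cell with `n ≥ 2`** (an anchor in every realisable cell; the wrong-sign cells are vacuous, part 5). [cite: vanGeemen1994HodgeAV, 4.14 and Lemma 5.2]
[cite: Deligne1982HodgeCycles, proof of Thm. 4.8] -/
theorem weilClassesByComponent_of_reachSimilar_of_anchorInClass (hF : weilFamilyReach_similar)
    (h : ∀ n : ℕ, 2 ≤ n → ∀ d : ℕ, 0 < d → ∀ δ : weilNormResidueGroup d,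
      HasLocallyAlgebraicWeilAnchorInClass n d δ) :
    WeilClassesByComponent :=
  fun n hn d hd δ => weilClassesComponent_of_reachSimilar_of_anchorInClass hF (by omega) hd (h n hn d hd δ)

/-- **THE FLOOR through door B.** `HC` for every complex abelian variety of dimension `≤ 5` from the four
refereed print facts (Moonen–Zarhin 1999, Koike 2004, Schoen 1998, Markman 2023), Deligne's reach-by-similitude
`weilFamilyReach_similar`, and ONE locally algebraic anchor in each realisable (= positive) non-split squarefree
fourfold cell `(2, d, δ)` (`d ≠ 1, 3` squarefree, `δ ≠ [1]`; `HasLocallyAlgebraicWeilAnchorInClass 2 d δ` is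
vacuous when `sign δ = -1`). [cite: MoonenZarhin1999, Thm. 0.1]
[cite: vanGeemen1994HodgeAV, (5.4.1), Lemma 5.2 (4), Thm. 6.12] [cite: Deligne1982HodgeCycles, proof of Thm. 4.8] -/
theorem hodgeConjectureFor_abelian_dim_le_five_of_refereed_reachSimilar_anchorInClass
    (hred : MoonenZarhin1999_hodgeClasses_abelian_dim_le_five_of_weilClassesFourfolds)
    (hK : Koike2004_weilClasses_algebraic_hyperbolicSixfold_one)
    (hS : Schoen1998_weilClasses_algebraic_hyperbolicSixfold_three)
    (hM23 : Markman2023_weilClasses_algebraic_discOneWeilFourfold)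
    (hF : weilFamilyReach_similar)
    (hP : ∀ d : ℕ, 0 < d → Squarefree d → d ≠ 1 → d ≠ 3 → ∀ δ : weilNormResidueGroup d,
      δ ≠ splitDiscriminantClass 2 d → HasLocallyAlgebraicWeilAnchorInClass 2 d δ)
    (A : AbelianVariety ℂ) (hA : A.dim ≤ 5) : HodgeConjectureFor A.dim A.X :=
  hodgeConjectureFor_abelian_dim_le_five_of_refereed_and_positive_residualSq_L hred hK hS hM23
    (fun d hd hsq h1 h3 δ hδ _ =>
      weilClassesComponent_of_reachSimilar_of_anchorInClass hF two_pos hd (hP d hd hsq h1 h3 δ hδ)) A hA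

/-- **R1 (`WeilSixfolds`) through door B**: `weilFamilyReach_similar` ∧ `HasLocallyAlgebraicWeilAnchorInClass 3 d δ`
on every sixfold cell (one locally algebraic anchor in every NEGATIVE cell `(3, d, δ)`, `sign δ = -1 = (-1)³`; the
positive ones carry no Weil sixfold and the predicate is vacuous there).
[cite: Deligne1982HodgeCycles, proof of Thm. 4.8] [cite: Schoen1998HodgeWeilAddendum, §10]
[cite: vanGeemen1994HodgeAV, 4.14 and Lemma 5.2] -/
theorem weilSixfolds_of_reachSimilar_of_anchorInClass (hF : weilFamilyReach_similar)
    (h : ∀ d : ℕ, 0 < d → ∀ δ : weilNormResidueGroup d, HasLocallyAlgebraicWeilAnchorInClass 3 d δ) :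
    Theses.SevenfoldWeilCensus.WeilSixfolds :=
  WeilTypeLadder.weilSixfolds_of_reachSimilar_of_similarAnchors hF fun d hd =>
    hasSimilarLocallyAlgebraicWeilAnchors_of_anchorInClass (by norm_num) hd (h d hd)

end Summit.HodgeConjecture.HodgeConjecture.Ring2.AbelianAll

end
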